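import Summits.ResolutionOfSingularities.ResolutionOfSingularities.Theorems.HilbertSamuelEliminationCampaignW42Thm3104Perfect
import Literature.AlgebraicGeometry.Resolution.PermissibleBlowupDirectrixRational
import Mathlib.FieldTheory.Perfect
import HarnessLib

/-!
# [OURS · L1 W4.2] CJS Thm. 3.10 (4) WITHOUT THE BINDER at PERFECT coefficient fields: `e_{x'}(X')_K + tr.deg ≤ e_x(X)_K`
# for every PERFECT `K`, and `e_{x'}(X') + tr.deg ≤ e_x(X)` whenever `κ(x)` and `κ(x')` are perfect (e.g. closed points over a
# perfect ground field) — from the unconditional ridge monotonicity (cell res-hironaka, librarian res-D-lib-1; `--supports`)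

HONEST FRAMING. OURS (HIRONAKA-L librarian res-D-lib-1 gen 7, for the W4.2 chain), FACT-FREE. The tree carries CJS Thm. 3.10 (4)
= Hironaka 1967 Thm. (1,A) as the NAMED FACT `CossartJannsenSaito2020_thm_3_10_4` (`Res.PermissibleBlowupDirectrix`), quantified
over EVERY field extension `K ⊇ κ(x')`: `e_{x'}(X')_K + δ_{x'/x} ≤ e_x(X)_K`. For PERFECT `K` the directrix dimension `e(·)_K` IS
Giraud's ridge dimension (`CampaignW42.localRidgeDim_eq_dirDimOver_of_perfectField`, from F-56 `Dietel2015_ridge_perfect_holds`),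
and the ridge inequality `dim F_{x'}(X') + δ ≤ dim F_x(X)` is a TREE THEOREM since res-L1-s42-pv-1's
`CampaignW42.ridgeDimDropAt_of_isNearPoint(_of_isExcellent)` (`…CampaignW42RidgeDimMonotone`, Dietel (8.2.7) (ii) for the ridge).
res-L1-s42-pv-1 packaged the perfect-`K` instances of the binder in `…CampaignW42Thm3104Perfect` (p546114:
`dirDimOver_add_trdeg_le_of_isNearPoint_of_perfectField`, `thm_3_10_4_of_perfectField`). This file adds the RESIDUE-FIELD doors
that the W-ladder rows use: at every near point whose residue fields `κ(x)`, `κ(x')` are perfect (closed points of a scheme of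
finite type over a perfect field; finite fields; characteristic 0), `e_{x'}(X') + δ ≤ e_x(X)` for the directrix dimensions
`Scheme.dirDim` themselves, with NO named fact; and `e_{x'}(X') ≤ e_x(X)` as soon as `κ(x)` is perfect and `κ(x')/κ(x)` is
algebraic. The IMPERFECT instances (`K = κ(x')` at a non-closed point,
or over an imperfect ground field) remain exactly the content of Hironaka 1967 Thm. (1,A) and are NOT claimed. NOTHING here is a
statement of H. Hironaka's manuscript [Hironaka2017]. AI-written; AI review is weaker than expert review.

## Contents (namespace `…Theorems.CampaignW42`)

* **`dirDim_add_trdeg_le_of_isNearPoint_of_perfectField`** — `κ(x')`, `κ(π x')` perfect ⟹ `e_{x'}(X') + δ ≤ e_{π x'}(X)`;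
* **`dirDim_le_dirDim_of_isNearPoint_of_isAlgebraic`** — `κ(π x')` perfect and `κ(x')/κ(π x')` algebraic (e.g. `x'` closed in
  the fibre of a closed point) ⟹ `e_{x'}(X') ≤ e_{π x'}(X)` — the binder-free form of
  `Res.dirDim_le_of_hsFun_eq_of_isIso_residueFieldMap` / `…WLadderNearPointDirDim.dirDim_le_dirDim_of_hsFun_eq_of_bijective`
  at perfect residue fields.

References (orientation only): V. Cossart, U. Jannsen, S. Saito, LNM 2270 (2020), Thm. 3.10 (4), Lemma 2.10, Rem. 18.29 (1)
[CossartJannsenSaito2020]; H. Hironaka, J. Math. Kyoto Univ. 7 (1967), Thm. (1,A) [Hironaka1967Characters]; B. Dietel (2015),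
Satz (8.2.7) (ii), Lemma (6.3.5) (ii) [Dietel2015]; J. Giraud (1975) [Giraud1975].
-/

noncomputable section

-- single-conjunct summit: the doubled namespace component `ResolutionOfSingularities` is mandated
set_option linter.dupNamespace false

open CategoryTheory AlgebraicGeometry TopologicalSpace IsLocalRing
open Literature.AlgebraicGeometry.Resolution Literature.RingTheory.HilbertSamuel

namespace Summit.ResolutionOfSingularities.ResolutionOfSingularities.Theorems

namespace CampaignW42

universe u

variable {X X' : Scheme.{u}} [IsLocallyNoetherian X] [IsLocallyNoetherian X'] {π : X' ⟶ X} {D : X.IdealSheafData}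

/-- **`e_{x'}(X') + tr.deg(κ(x')/κ(x)) ≤ e_x(X)` at a near point with PERFECT residue fields `κ(x')`, `κ(x)` — no binder**
(`e = e_{κ}` is the ridge dimension when `κ` is perfect). [cite: CossartJannsenSaito2020, Thm. 3.10 (4), Def. 2.18]
[cite: Dietel2015, Satz (8.2.7) (ii), Lemma (6.3.5) (ii)] -/
theorem dirDim_add_trdeg_le_of_isNearPoint_of_perfectField (hπ : IsBlowup π D) (x' : X')
    (hperm : IdealSheafData.IsPermissibleAt D (π.base x')) (hUC : IsUniversallyCatenaryRing (X.presheaf.stalk (π.base x')))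
    {N : ℕ} (hnear : IsNearPoint π N x') [PerfectField (ResidueField (X'.presheaf.stalk x'))]
    [PerfectField (ResidueField (X.presheaf.stalk (π.base x')))] :
    (Scheme.dirDim X' x' : Cardinal.{u}) +
        @Algebra.trdeg (ResidueField (X.presheaf.stalk (π.base x'))) (ResidueField (X'.presheaf.stalk x')) _ _
          (π.residueFieldMap x').hom.toAlgebra ≤
      (Scheme.dirDim X (π.base x') : Cardinal.{u}) := by
  have h := ridgeDimDropAt_of_isNearPoint hπ x' hperm hUC hnear
  unfold RidgeDimDropAt at h
  have h1 : Scheme.ridgeDim X' x' = Scheme.dirDim X' x' := by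
    rw [← Scheme.dirDimOver_residueField]
    exact localRidgeDim_eq_dirDimOver_of_perfectField (X'.presheaf.stalk x') _
  have h2 : Scheme.ridgeDim X (π.base x') = Scheme.dirDim X (π.base x') := by
    rw [← Scheme.dirDimOver_residueField]
    exact localRidgeDim_eq_dirDimOver_of_perfectField (X.presheaf.stalk (π.base x')) _
  rw [h1, h2] at h
  exact h

/-- **`e_{x'}(X') ≤ e_x(X)` at a near point with `κ(x)` PERFECT and `κ(x')/κ(x)` ALGEBRAIC** (e.g. a closed point of the
fibre over a closed point of a scheme of finite type over a perfect field; in particular every near point with `κ(x) ⥲ κ(x')`)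
— the binder-free form, at perfect residue fields, of `Res.dirDim_le_of_hsFun_eq_of_isIso_residueFieldMap`.
[cite: CossartJannsenSaito2020, Thm. 3.10 (4), Def. 2.18] [cite: Dietel2015, Satz (8.2.7) (ii), Lemma (6.3.5) (ii)] -/
theorem dirDim_le_dirDim_of_isNearPoint_of_isAlgebraic (hπ : IsBlowup π D) (x' : X')
    (hperm : IdealSheafData.IsPermissibleAt D (π.base x')) (hUC : IsUniversallyCatenaryRing (X.presheaf.stalk (π.base x')))
    {N : ℕ} (hnear : IsNearPoint π N x') [PerfectField (ResidueField (X.presheaf.stalk (π.base x')))]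
    (halg : @Algebra.IsAlgebraic (ResidueField (X.presheaf.stalk (π.base x'))) (ResidueField (X'.presheaf.stalk x')) _ _
      (π.residueFieldMap x').hom.toAlgebra) :
    Scheme.dirDim X' x' ≤ Scheme.dirDim X (π.base x') := by
  letI : Algebra (ResidueField (X.presheaf.stalk (π.base x'))) (ResidueField (X'.presheaf.stalk x')) :=
    (π.residueFieldMap x').hom.toAlgebra
  haveI : PerfectField (ResidueField (X'.presheaf.stalk x')) :=
    Algebra.IsAlgebraic.perfectField (ResidueField (X.presheaf.stalk (π.base x')))
  have h := dirDim_add_trdeg_le_of_isNearPoint_of_perfectField hπ x' hperm hUC hnear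
  have h' : (Scheme.dirDim X' x' : Cardinal.{u}) ≤ (Scheme.dirDim X (π.base x') : Cardinal.{u}) :=
    le_trans (self_le_add_right _ _) h
  exact_mod_cast h'

/-- **Excellent `X`, `D` permissible: `e_{x'}(X') ≤ e_x(X)` at every near point over `supp D` with `κ(x)` perfect and
`κ(x')/κ(x)` algebraic — no binder.** [cite: CossartJannsenSaito2020, Thm. 3.10 (4), Def. 2.18] [cite: Dietel2015, Satz (8.2.7) (ii)] -/
theorem dirDim_le_dirDim_of_isNearPoint_of_isAlgebraic_of_isExcellent (hX : Scheme.IsExcellent X)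
    (hD : IdealSheafData.IsPermissible D) (hπ : IsBlowup π D) {N : ℕ} (x' : X') (hx : π.base x' ∈ (D.support : Set X))
    (hnear : IsNearPoint π N x') [PerfectField (ResidueField (X.presheaf.stalk (π.base x')))]
    (halg : @Algebra.IsAlgebraic (ResidueField (X.presheaf.stalk (π.base x'))) (ResidueField (X'.presheaf.stalk x')) _ _
      (π.residueFieldMap x').hom.toAlgebra) :
    Scheme.dirDim X' x' ≤ Scheme.dirDim X (π.base x') :=
  dirDim_le_dirDim_of_isNearPoint_of_isAlgebraic hπ x' (hD _ hx) (hX.isUniversallyCatenaryRing_stalk _) hnear halg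

end CampaignW42

end Summit.ResolutionOfSingularities.ResolutionOfSingularities.Theorems

end
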